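import Mathlib.Data.Finset.Preimage
import Literature.AlgebraicGeometry.Frobenioids.Monoids
import HarnessLib

/-!
# Frobenioids I, §0: WITHOUT integrality the divisibility order `Order(M)` of a sharp monoid CAN have a Boolean factor

S. Mochizuki, *The geometry of Frobenioids I: the general theory*, Kyushu J. Math. **62** (2008), §0 "Monoids"
(kurims pp. 11–12): sharp / integral / torsion-free monoids, the relation `a ≤ b` (here `a ∣ b`) and the partially
ordered set `Order(M)` [cite: MochizukiFrdI2008, §0 p.12].

PROOF-ONLY file (0 definitions, 0 instances, 0 notation), abc-iut cell, seat abc-iut-f-128 (gen 16); companion of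
`DivisibilityOrderNoBooleanFactor.lean` (abc-iut-f-128 gen 15, ★ p557764), recorded for the census of FACT-LIST row F-2809
(`Cor38Hyp.PreservesPreSteps`, [EtTh] Cor. 3.8 proof row C38-L02a).  That file answers NO to the combinatorial kernel of
the walking-arrow residual — «is there a sharp divisor monoid `K` with `Order(K) ≅ {0 < 1} × Order(K)`?» — for INTEGRAL
(cancellative) `K` without `2`-torsion.  THIS FILE shows that the integrality hypothesis there is NECESSARY, i.e. that the
poset obstruction does NOT close the residual for non-integral divisor monoids (which the typed [EtTh] Def. 3.6 (ii)
interface admits: "divisorial" / "perf-factorial" are vocabulary clauses; cf. the sister hand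
`EtaleTheta/TemperedFrobenioidDivisorsIdempotentFree.lean` for what the interface does exclude):

* **`exists_isSharp_dvd_iso_bool_prod`** — there is a commutative monoid `H` which is SHARP, IDEMPOTENT-FREE, satisfies
  `a·a = b·b ⇒ a = b` (the `2`-torsion hypothesis of p557764) and is NOT cancellative, together with a bijection
  `f : Bool × H ≃ H` translating the product order (`false < true`, divisibility on `H`) into divisibility:
  `f x ∣ f y ↔ x ≤ y`.  WITNESS: `H := ⟨ℓ, x₀, x₁, x₂, … | x_k·x_k = x_k·ℓ⟩`, realised on `ℕ × Finset ℕ` as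
  `(a, S)·(b, T) := (a + b + |S ∩ T|, S ∪ T)` (normal form `ℓ^a · ∏_{k ∈ S} x_k`); divisibility is `a ≤ b ∧ S ⊆ T`, so
  `Order(H) ≅ (ℕ, ≤) × (Finset ℕ, ⊆)` and `S ↦ {0 | β} ∪ (S + 1)` absorbs one more Boolean coordinate.  (`H^gp = ℤ·ℓ`,
  the class of `(a, S)` being `a + |S|`; only `1 = (0, ∅)` has trivial class; `x_k·x_k = x_k·ℓ` with `x_k ≠ ℓ`.)
Nothing here is specific to Frobenioids; no statement of the paper is transcribed or strengthened; typed ≠ proved.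
-/

namespace Literature.AlgebraicGeometry.Frobenioids

/-- Inclusion–exclusion bookkeeping: `|S ∩ T| + |(S ∪ T) ∩ U| = |T ∩ U| + |S ∩ (T ∪ U)|` (both sides equal
`|S ∩ T| + |S ∩ U| + |T ∩ U| − |S ∩ T ∩ U|`) — the associativity of `(a, S)·(b, T) := (a + b + |S ∩ T|, S ∪ T)`. [folklore] -/
private theorem card_inter_add_card_union_inter (S T U : Finset ℕ) :
    (S ∩ T).card + ((S ∪ T) ∩ U).card = (T ∩ U).card + (S ∩ (T ∪ U)).card := by
  have h1 := Finset.card_union_add_card_inter (S ∩ U) (T ∩ U)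
  have h2 := Finset.card_union_add_card_inter (S ∩ T) (S ∩ U)
  have e1 : (S ∪ T) ∩ U = S ∩ U ∪ T ∩ U := Finset.union_inter_distrib_right S T U
  have e2 : S ∩ (T ∪ U) = S ∩ T ∪ S ∩ U := Finset.inter_union_distrib_left S T U
  have e3 : S ∩ U ∩ (T ∩ U) = S ∩ T ∩ (S ∩ U) := by
    ext n
    simp only [Finset.mem_inter]
    tauto
  rw [e1, e2]
  rw [e3] at h1
  omega

/-- Membership in the lifted set `{0 | β} ∪ (S + 1)`. [folklore] -/
private theorem mem_lift_iff (β : Bool) (S : Finset ℕ) (n : ℕ) :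
    n ∈ (if β = true then ({0} : Finset ℕ) else ∅) ∪ S.map ⟨Nat.succ, Nat.succ_injective⟩ ↔
      (n = 0 ∧ β = true) ∨ ∃ k ∈ S, k + 1 = n := by
  rw [Finset.mem_union, Finset.mem_map]
  constructor
  · rintro (h | ⟨k, hk, rfl⟩)
    · left
      revert h
      cases β <;> simp
    · exact Or.inr ⟨k, hk, rfl⟩
  · rintro (⟨rfl, rfl⟩ | ⟨k, hk, rfl⟩)
    · left
      simp
    · exact Or.inr ⟨k, hk, rfl⟩

/-- `0` lies in the lifted set iff the Boolean coordinate is `true`. [folklore] -/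
private theorem zero_mem_lift_iff (β : Bool) (S : Finset ℕ) :
    0 ∈ (if β = true then ({0} : Finset ℕ) else ∅) ∪ S.map ⟨Nat.succ, Nat.succ_injective⟩ ↔ β = true := by
  rw [mem_lift_iff]
  constructor
  · rintro (⟨-, h⟩ | ⟨k, -, hk⟩)
    · exact h
    · exact absurd hk (Nat.succ_ne_zero k)
  · exact fun h => Or.inl ⟨rfl, h⟩

/-- `k + 1` lies in the lifted set iff `k ∈ S`. [folklore] -/
private theorem succ_mem_lift_iff (β : Bool) (S : Finset ℕ) (k : ℕ) :
    k + 1 ∈ (if β = true then ({0} : Finset ℕ) else ∅) ∪ S.map ⟨Nat.succ, Nat.succ_injective⟩ ↔ k ∈ S := by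
  rw [mem_lift_iff]
  constructor
  · rintro (⟨h, -⟩ | ⟨k', hk', h⟩)
    · exact absurd h (Nat.succ_ne_zero k)
    · rwa [← Nat.succ_injective h]
  · exact fun h => Or.inr ⟨k, h, rfl⟩

/-- The lift is monotone exactly for the product order: `{0|β} ∪ (S+1) ⊆ {0|β'} ∪ (S'+1) ↔ β ≤ β' ∧ S ⊆ S'`. [folklore] -/
private theorem lift_subset_lift_iff (β β' : Bool) (S S' : Finset ℕ) :
    (if β = true then ({0} : Finset ℕ) else ∅) ∪ S.map ⟨Nat.succ, Nat.succ_injective⟩ ⊆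
        (if β' = true then ({0} : Finset ℕ) else ∅) ∪ S'.map ⟨Nat.succ, Nat.succ_injective⟩ ↔
      β ≤ β' ∧ S ⊆ S' := by
  constructor
  · intro h
    refine ⟨?_, fun k hk => ?_⟩
    · cases hβ : β
      · exact Bool.false_le _
      · have h0 : 0 ∈ (if β' = true then ({0} : Finset ℕ) else ∅) ∪ S'.map ⟨Nat.succ, Nat.succ_injective⟩ :=
          h ((zero_mem_lift_iff β S).2 hβ)
        rw [(zero_mem_lift_iff β' S').1 h0]
    · exact (succ_mem_lift_iff β' S' k).1 (h ((succ_mem_lift_iff β S k).2 hk))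
  · rintro ⟨hβ, hS⟩ n hn
    rcases (mem_lift_iff β S n).1 hn with ⟨rfl, hb⟩ | ⟨k, hk, rfl⟩
    · have hβ' : β' = true := by
        revert hβ hb
        cases β <;> cases β' <;> simp
      exact (zero_mem_lift_iff β' S').2 hβ'
    · exact (succ_mem_lift_iff β' S' k).2 (hS hk)

/-- Round trip, Boolean coordinate: `0 ∈ {0|β} ∪ (S+1)` decides to `β`. [folklore] -/
private theorem decide_zero_mem_lift (β : Bool) (S : Finset ℕ) :
    decide (0 ∈ (if β = true then ({0} : Finset ℕ) else ∅) ∪ S.map ⟨Nat.succ, Nat.succ_injective⟩) = β := by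
  rw [Bool.eq_iff_iff, decide_eq_true_iff]
  exact zero_mem_lift_iff β S

/-- Round trip, set coordinate: the `succ`-preimage of `{0|β} ∪ (S+1)` is `S`. [folklore] -/
private theorem preimage_succ_lift (β : Bool) (S : Finset ℕ) :
    ((if β = true then ({0} : Finset ℕ) else ∅) ∪ S.map ⟨Nat.succ, Nat.succ_injective⟩).preimage Nat.succ
        Nat.succ_injective.injOn = S := by
  ext k
  rw [Finset.mem_preimage]
  exact succ_mem_lift_iff β S k

/-- Round trip the other way: `T = {0 | 0 ∈ T} ∪ ((T − 1) + 1)`. [folklore] -/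
private theorem lift_unlift (T : Finset ℕ) :
    (if decide (0 ∈ T) = true then ({0} : Finset ℕ) else ∅) ∪
        (T.preimage Nat.succ Nat.succ_injective.injOn).map ⟨Nat.succ, Nat.succ_injective⟩ = T := by
  ext n
  rcases n with _ | k
  · rw [zero_mem_lift_iff]
    exact decide_eq_true_iff
  · rw [succ_mem_lift_iff, Finset.mem_preimage]

/-- **Without integrality, `Order(M)` CAN have a Boolean factor.**  There is a commutative monoid `H` that is sharp,
idempotent-free, satisfies `a·a = b·b ⇒ a = b`, is NOT cancellative, and admits a bijection `f : Bool × H ≃ H` with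
`f x ∣ f y ↔ x ≤ y` for the product order (`false < true`, divisibility on `H`) — so the `[IsCancelMul]` hypothesis of
`not_dvd_iso_bool_prod` cannot be dropped.  Witness: `ℕ × Finset ℕ` with `(a, S)·(b, T) := (a + b + |S ∩ T|, S ∪ T)`,
i.e. `⟨ℓ, x_k (k ∈ ℕ) | x_k·x_k = x_k·ℓ⟩`; divisibility is `a ≤ b ∧ S ⊆ T`; `f (β, (a, S)) := (a, {0|β} ∪ (S+1))`.
[cite: MochizukiFrdI2008, §0 p.12] -/
theorem exists_isSharp_dvd_iso_bool_prod :
    ∃ (H : Type) (_ : CommMonoid H),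
      IsSharp H ∧ (∀ a : H, a * a = a → a = 1) ∧ (∀ a b : H, a * a = b * b → a = b) ∧ ¬ IsCancelMul H ∧
        ∃ f : Bool × H ≃ H, ∀ x y : Bool × H, f x ∣ f y ↔ (x.1 ≤ y.1 ∧ x.2 ∣ y.2) := by
  -- the monoid structure on `ℕ × Finset ℕ`
  letI inst : CommMonoid (ℕ × Finset ℕ) :=
    { mul := fun x y => (x.1 + y.1 + (x.2 ∩ y.2).card, x.2 ∪ y.2)
      one := (0, ∅)
      mul_assoc := fun x y z => by
        refine Prod.ext ?_ (Finset.union_assoc x.2 y.2 z.2)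
        change x.1 + y.1 + (x.2 ∩ y.2).card + z.1 + ((x.2 ∪ y.2) ∩ z.2).card =
          x.1 + (y.1 + z.1 + (y.2 ∩ z.2).card) + (x.2 ∩ (y.2 ∪ z.2)).card
        have := card_inter_add_card_union_inter x.2 y.2 z.2
        omega
      one_mul := fun x => by
        refine Prod.ext ?_ (Finset.empty_union x.2)
        change 0 + x.1 + ((∅ : Finset ℕ) ∩ x.2).card = x.1
        rw [Finset.empty_inter, Finset.card_empty]
        omega
      mul_one := fun x => by
        refine Prod.ext ?_ (Finset.union_empty x.2)
        change x.1 + 0 + (x.2 ∩ (∅ : Finset ℕ)).card = x.1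
        rw [Finset.inter_empty, Finset.card_empty]
        omega
      mul_comm := fun x y => by
        refine Prod.ext ?_ (Finset.union_comm x.2 y.2)
        change x.1 + y.1 + (x.2 ∩ y.2).card = y.1 + x.1 + (y.2 ∩ x.2).card
        rw [Finset.inter_comm]
        omega }
  have mul_def : ∀ x y : ℕ × Finset ℕ, x * y = (x.1 + y.1 + (x.2 ∩ y.2).card, x.2 ∪ y.2) := fun _ _ => rfl
  have one_def : (1 : ℕ × Finset ℕ) = (0, ∅) := rfl
  -- divisibility is the product order `a ≤ b ∧ S ⊆ T`
  have dvd_iff : ∀ x y : ℕ × Finset ℕ, x ∣ y ↔ x.1 ≤ y.1 ∧ x.2 ⊆ y.2 := by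
    intro x y
    constructor
    · rintro ⟨c, rfl⟩
      rw [mul_def]
      exact ⟨by dsimp only; omega, Finset.subset_union_left⟩
    · rintro ⟨h1, h2⟩
      refine ⟨(y.1 - x.1, y.2 \ x.2), ?_⟩
      rw [mul_def]
      refine Prod.ext ?_ ?_
      · change y.1 = x.1 + (y.1 - x.1) + (x.2 ∩ (y.2 \ x.2)).card
        rw [Finset.inter_sdiff_self, Finset.card_empty]
        omega
      · change y.2 = x.2 ∪ (y.2 \ x.2)
        rw [Finset.union_sdiff_of_subset h2]
  refine ⟨ℕ × Finset ℕ, inst, ⟨fun a ha => ?_⟩, fun a ha => ?_, fun a b hab => ?_, fun hc => ?_, ?_⟩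
  · -- sharp: a unit has `a.1 + b.1 + _ = 0` and `a.2 ∪ b.2 = ∅`
    obtain ⟨b, hb⟩ := ha.exists_right_inv
    rw [mul_def, one_def, Prod.mk.injEq] at hb
    refine Prod.ext ?_ ?_
    · change a.1 = 0
      omega
    · change a.2 = ∅
      exact (Finset.union_eq_empty.1 hb.2).1
  · -- idempotent-free: `2a + |S| = a` forces `a = 0`, `S = ∅`
    rw [mul_def, Finset.inter_self, Finset.union_self] at ha
    have h1 : a.1 + a.1 + a.2.card = a.1 := congrArg Prod.fst ha
    refine Prod.ext ?_ ?_
    · change a.1 = 0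
      omega
    · change a.2 = ∅
      exact Finset.card_eq_zero.1 (by omega)
  · -- `a·a = b·b ⇒ a = b`: compare `(2a + |S|, S)` with `(2b + |T|, T)`
    rw [mul_def, mul_def, Finset.inter_self, Finset.union_self, Finset.inter_self, Finset.union_self,
      Prod.mk.injEq] at hab
    refine Prod.ext ?_ hab.2
    have h1 := hab.1
    rw [hab.2] at h1
    change a.1 = b.1
    omega
  · -- not cancellative: `x₀·x₀ = x₀·ℓ` with `x₀ = (0, {0}) ≠ ℓ = (1, ∅)`
    haveI := hc
    have h : ((0, {0}) : ℕ × Finset ℕ) * (0, {0}) = ((0, {0}) : ℕ × Finset ℕ) * (1, ∅) := by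
      rw [mul_def, mul_def]
      simp
    have h' := congrArg Prod.fst (mul_left_cancel h)
    exact absurd h' (by simp)
  · -- the Boolean factor: `f (β, (a, S)) := (a, {0|β} ∪ (S+1))`
    let f : Bool × (ℕ × Finset ℕ) ≃ ℕ × Finset ℕ :=
      { toFun := fun x =>
          (x.2.1, (if x.1 = true then ({0} : Finset ℕ) else ∅) ∪ x.2.2.map ⟨Nat.succ, Nat.succ_injective⟩)
        invFun := fun y => (decide (0 ∈ y.2), (y.1, y.2.preimage Nat.succ Nat.succ_injective.injOn))
        left_inv := fun x =>
          Prod.ext (decide_zero_mem_lift x.1 x.2.2) (Prod.ext rfl (preimage_succ_lift x.1 x.2.2))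
        right_inv := fun y => Prod.ext rfl (lift_unlift y.2) }
    refine ⟨f, fun x y => ?_⟩
    rw [dvd_iff, dvd_iff]
    change (x.2.1 ≤ y.2.1 ∧
        (if x.1 = true then ({0} : Finset ℕ) else ∅) ∪ x.2.2.map ⟨Nat.succ, Nat.succ_injective⟩ ⊆
          (if y.1 = true then ({0} : Finset ℕ) else ∅) ∪ y.2.2.map ⟨Nat.succ, Nat.succ_injective⟩) ↔
      (x.1 ≤ y.1 ∧ x.2.1 ≤ y.2.1 ∧ x.2.2 ⊆ y.2.2)
    rw [lift_subset_lift_iff x.1 y.1 x.2.2 y.2.2]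
    tauto

end Literature.AlgebraicGeometry.Frobenioids
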